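import Summits.AtomisticToContinuum.FouriersLaw.Theorems.PhononMeanFreePathBoundaryKuboSumRule

/-!
# Corrector identity for the two-mode profile, part 2: the weight-tested Dynkin identity from a pointwise Doob–Dynkin identity
(helper, `--supports` crux stmt-AtomisticToContinuum-12111 `PuiseuxTransferLedger.TwoModeBulk`, line `Sketch`)

For the pinned anharmonic chain `P = pinnedChain ω₂ lam β γ` (`ω₂ > 0`, `lam, β, γ ≥ 0`) with `N + 1` sites, both
baths at `T > 0`, Gibbs weight `ρ = e^{-H/T}`, the CONSTRUCTED kernels `K_s = transitionKernel (N+1) T T s` and the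
reversed kernels `P̂_s = langevinRevKernel (N+1) T T s`, and three continuous observables `w, W, A` of exponential
class `O(e^{H/(4T)})`:

* `pinnedChain_testedDynkin_of_pointwise` — IF the weight `w` satisfies the pointwise Doob–Dynkin identity
  `e^{2γu} P̂_u(wρ)(y) - w(y)ρ(y) = ∫₀ᵘ e^{2γs} P̂_s(Wρ)(y) ds` (`u ≥ 0`, all `y`; i.e. `W = (L w)∘Θ` in the smooth
  case), THEN for every `S ≥ 0`
  `∫ w (K_S A) ρ dx - ∫ w A ρ dx = ∫₀^S ∫ W (K_s A) ρ dx ds`.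

This is the proof of `pinnedChain_sumRule_density` (`Theorems/PhononMeanFreePathBoundaryKuboSumRuleAux2.lean`, weight
`w = H`, `W = LH`) and of `pinnedChain_profileSumRule_density` made GENERIC in the weight: Lebesgue duality of the
Langevin kernels `∫ wρ (K_s f) dx = e^{2γs} ∫ f · P̂_s(wρ) dy` (`pinnedChain_gibbs_duality`) for the two weights
`w, W`, the hypothesis in place of the energy's Doob–Dynkin identity, and Fubini in `(s, y)`. It is used with
`w = E_{≤m}` (a left block energy), `W = γ(T - p_0²) + j_m` (part 1, `pinnedChain_leftEnergy_doobDynkin`).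
No definitions; nothing here closes the item.
-/

noncomputable section

open scoped NNReal ENNReal Topology
open MeasureTheory Filter Set

namespace Summit.AtomisticToContinuum.FouriersLaw.Theorems.TwoModeBulk.Sketch

open Literature.MathematicalPhysics.KineticTheory.HeatConduction
open Literature.MathematicalPhysics.KineticTheory Literature.Probability.Process OscillatorChain
open ProbabilityTheory
open Summit.AtomisticToContinuum.FouriersLaw.Theorems.SubdiffusiveBondHeat
open Summit.AtomisticToContinuum.FouriersLaw.Theorems.IncoherentBounded
open Summit.AtomisticToContinuum.FouriersLaw.Theorems.BoundaryKubo.GibbsTtcf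

/-- **The weight-tested Dynkin identity from a pointwise Doob–Dynkin identity.** For the `(N+1)`-site pinned chain
(`ω₂ > 0`, `lam, β, γ ≥ 0`), both baths at `T > 0`, `ρ = e^{-H/T}`, `K_s = transitionKernel (N+1) T T s`,
`P̂_s = langevinRevKernel (N+1) T T s`, and continuous `w, W, A` with `|w|, |W|, |A| = O(e^{H/(4T)})`: if
`e^{2γu} ∫ wρ dP̂_u(y,·) - w(y)ρ(y) = ∫₀ᵘ e^{2γs} ∫ Wρ dP̂_s(y,·) ds` for all `u ≥ 0`, `y`, then for all `S ≥ 0`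
`∫ w (K_S A) ρ dx - ∫ w A ρ dx = ∫₀^S ∫ W (K_s A) ρ dx ds` (Lebesgue duality `pinnedChain_gibbs_duality` for the
weights `w` and `W`, the hypothesis, Fubini in `(s, y)`). [folklore] -/
theorem pinnedChain_testedDynkin_of_pointwise {ω₂ lam β γ : ℝ} (hω : 0 < ω₂) (hl : 0 ≤ lam) (hβ : 0 ≤ β)
    (hγ : 0 ≤ γ) (N : ℕ) {T : ℝ} (hT : 0 < T) {w W A : PhaseSpace (N + 1) → ℝ}
    (hwc : Continuous w) (hWc : Continuous W) (hAc : Continuous A) {Cw CW CA : ℝ}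
    (hwb : ∀ x, |w x| ≤ Cw * Real.exp (1 / (4 * T) * (pinnedChain ω₂ lam β γ).hamiltonian (N + 1) x))
    (hWb : ∀ x, |W x| ≤ CW * Real.exp (1 / (4 * T) * (pinnedChain ω₂ lam β γ).hamiltonian (N + 1) x))
    (hAb : ∀ x, |A x| ≤ CA * Real.exp (1 / (4 * T) * (pinnedChain ω₂ lam β γ).hamiltonian (N + 1) x))
    (hpt : ∀ u : ℝ, 0 ≤ u → ∀ y : PhaseSpace (N + 1),
      Real.exp (2 * γ * u) *
            (∫ x, w x * (pinnedChain ω₂ lam β γ).gibbsDensity (N + 1) T x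
              ∂((pinnedChain ω₂ lam β γ).langevinRevKernel (N + 1) T T u.toNNReal y)) -
          w y * (pinnedChain ω₂ lam β γ).gibbsDensity (N + 1) T y =
        ∫ s in (0 : ℝ)..u, Real.exp (2 * γ * s) *
          ∫ x, W x * (pinnedChain ω₂ lam β γ).gibbsDensity (N + 1) T x
            ∂((pinnedChain ω₂ lam β γ).langevinRevKernel (N + 1) T T s.toNNReal y))
    {S : ℝ} (hS : 0 ≤ S) :
    (∫ x, w x * (∫ y, A y ∂((pinnedChain ω₂ lam β γ).transitionKernel (N + 1) T T S.toNNReal x)) *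
        (pinnedChain ω₂ lam β γ).gibbsDensity (N + 1) T x) -
      ∫ x, w x * A x * (pinnedChain ω₂ lam β γ).gibbsDensity (N + 1) T x =
    ∫ s in (0 : ℝ)..S, ∫ x, W x * (∫ y, A y ∂((pinnedChain ω₂ lam β γ).transitionKernel (N + 1) T T s.toNNReal x)) *
        (pinnedChain ω₂ lam β γ).gibbsDensity (N + 1) T x := by
  -- adapted from `BoundaryKubo.GibbsTtcf.pinnedChain_sumRule_density` (weight `H` ↦ generic `w`)
  -- notation
  set P := pinnedChain ω₂ lam β γ with hPdef
  have hP : P.IsConfining := pinnedChain_isConfining hω hl hβ hγ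
  have hM : 0 < N + 1 := Nat.succ_pos N
  set ρ := P.gibbsDensity (N + 1) T with hρdef
  set Hm := P.hamiltonian (N + 1) with hHm
  set K : ℝ≥0 → Kernel (PhaseSpace (N + 1)) (PhaseSpace (N + 1)) := P.transitionKernel (N + 1) T T with hK
  set Kr : ℝ≥0 → Kernel (PhaseSpace (N + 1)) (PhaseSpace (N + 1)) := P.langevinRevKernel (N + 1) T T with hKr
  show (∫ x, w x * (∫ y, A y ∂(K S.toNNReal x)) * ρ x) - ∫ x, w x * A x * ρ x =
    ∫ s in (0:ℝ)..S, ∫ x, W x * (∫ y, A y ∂(K s.toNNReal x)) * ρ x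
  -- the exponent `θ = 1/(4T)`
  set θ : ℝ := 1 / (4 * T) with hθ
  have hθ0 : 0 < θ := by positivity
  have hθ' : θ < 1 / max T T := by
    rw [max_self, hθ]; exact one_div_lt_one_div_of_lt hT (by linarith)
  have h2θ : 2 * θ < 1 / T := by
    rw [hθ, show 2 * (1 / (4 * T)) = 1 / (2 * T) by field_simp; ring]
    exact one_div_lt_one_div_of_lt hT (by linarith)
  have hθ1 : θ < 1 / T := by linarith
  -- continuity, nonnegativity of the constants
  have hHc : Continuous Hm := pinnedChain_continuous_hamiltonian ω₂ lam β γ (N + 1)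
  have hρc : Continuous ρ := pinnedChain_continuous_gibbsDensity ω₂ lam β γ (N + 1) T
  have hρ0 : ∀ x, 0 ≤ ρ x := fun x => (P.gibbsDensity_pos (N + 1) T x).le
  have hH0 : ∀ x, 0 ≤ Hm x := fun x => hP.hamiltonian_nonneg (N + 1) x
  have hCw : 0 ≤ Cw := nonneg_of_mul_nonneg_left ((abs_nonneg _).trans (hwb 0)) (Real.exp_pos _)
  have hCW : 0 ≤ CW := nonneg_of_mul_nonneg_left ((abs_nonneg _).trans (hWb 0)) (Real.exp_pos _)
  have hCA : 0 ≤ CA := nonneg_of_mul_nonneg_left ((abs_nonneg _).trans (hAb 0)) (Real.exp_pos _)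
  -- the case `S = 0`: both sides vanish
  obtain rfl | hS0 := hS.eq_or_lt
  · have hK0 : K (Real.toNNReal 0) = Kernel.id := by
      rw [Real.toNNReal_zero]; exact pinnedChain_transitionKernel_zero hω hl hβ hγ (N + 1) _ _
    rw [hK0, intervalIntegral.integral_same]
    simp only [Kernel.id_apply, integral_dirac, sub_self]
  -- the case `S > 0`
  set Sn := S.toNNReal with hSn
  have hSn0 : 0 < Sn := Real.toNNReal_pos.2 hS0
  have hSnc : ((Sn : ℝ≥0) : ℝ) = S := Real.coe_toNNReal _ hS
  set Φ : PhaseSpace (N + 1) → ℝ := fun y => ∫ x, w x * ρ x ∂(Kr Sn y) with hΦ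
  set Ψ : ℝ → PhaseSpace (N + 1) → ℝ := fun s y => ∫ x, W x * ρ x ∂(Kr s.toNNReal y) with hΨ
  -- (a) duality at time `S` with the weight `w`
  obtain ⟨hi1, -, hd1⟩ := pinnedChain_gibbs_duality hω hl hβ hγ hM hT hT hT hθ0 hθ' h2θ hwc hAc hwb hAb hSn0
  rw [hSnc] at hd1
  have hLHS : ∫ x, w x * (∫ y, A y ∂(K Sn x)) * ρ x = Real.exp (2 * γ * S) * ∫ y, A y * Φ y :=
    calc ∫ x, w x * (∫ y, A y ∂(K Sn x)) * ρ x = ∫ x, w x * ρ x * ∫ y, A y ∂(K Sn x) :=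
          integral_congr_ae (Eventually.of_forall fun x => by ring)
      _ = Real.exp (2 * γ * S) * ∫ y, A y * Φ y := hd1
  -- (b) the pointwise Doob–Dynkin identity for the weight
  have hpt' : ∀ y, Real.exp (2 * γ * S) * Φ y - w y * ρ y = ∫ s in (0:ℝ)..S, Real.exp (2 * γ * s) * Ψ s y :=
    fun y => hpt S hS y
  -- (c) integrate against `A(y) dy`
  have hwt1 : Integrable (fun x => Real.exp (θ * Hm x) * ρ x) :=
    pinnedChain_integrable_exp_mul_gibbsDensity hω hl hβ γ (N + 1) hT hθ1
  have hwt2 : Integrable (fun x => Real.exp (2 * θ * Hm x) * ρ x) :=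
    pinnedChain_integrable_exp_mul_gibbsDensity hω hl hβ γ (N + 1) hT h2θ
  have hAwρ : Integrable (fun y => w y * A y * ρ y) :=
    (hwt2.const_mul (Cw * CA)).mono' ((hwc.mul hAc).mul hρc).aestronglyMeasurable
      (Eventually.of_forall fun y => by
        rw [Real.norm_eq_abs, abs_mul, abs_mul, abs_of_nonneg (hρ0 y), ← mul_assoc]
        refine mul_le_mul_of_nonneg_right ?_ (hρ0 y)
        calc |w y| * |A y| ≤ (Cw * Real.exp (θ * Hm y)) * (CA * Real.exp (θ * Hm y)) :=
              mul_le_mul (hwb y) (hAb y) (abs_nonneg _) (by positivity)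
          _ = Cw * CA * Real.exp (2 * θ * Hm y) := by
              rw [show 2 * θ * Hm y = θ * Hm y + θ * Hm y by ring, Real.exp_add]; ring)
  have hΦm : StronglyMeasurable Φ := (hwc.mul hρc).stronglyMeasurable.integral_kernel (κ := Kr Sn)
  have hAΦ : Integrable (fun y => A y * Φ y) :=
    hi1.mono' (hAc.aestronglyMeasurable.mul hΦm.aestronglyMeasurable)
      (Eventually.of_forall fun y => by
        rw [norm_mul, Real.norm_eq_abs]
        refine mul_le_mul_of_nonneg_left ?_ (abs_nonneg _)
        calc ‖Φ y‖ ≤ ∫ x, ‖w x * ρ x‖ ∂(Kr Sn y) := norm_integral_le_integral_norm _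
          _ = ∫ x, |w x| * ρ x ∂(Kr Sn y) := integral_congr_ae (Eventually.of_forall fun x => by
              show ‖w x * ρ x‖ = |w x| * ρ x
              rw [norm_mul, Real.norm_eq_abs, Real.norm_of_nonneg (hρ0 x)]))
  have hstep : (∫ x, w x * (∫ y, A y ∂(K Sn x)) * ρ x) - ∫ x, w x * A x * ρ x =
      ∫ y, ∫ s in (0:ℝ)..S, A y * (Real.exp (2 * γ * s) * Ψ s y) := by
    have e : ∀ y, Real.exp (2 * γ * S) * (A y * Φ y) - w y * A y * ρ y =
        ∫ s in (0:ℝ)..S, A y * (Real.exp (2 * γ * s) * Ψ s y) := by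
      intro y
      rw [intervalIntegral.integral_const_mul, ← hpt' y]; ring
    rw [hLHS, ← integral_const_mul (Real.exp (2 * γ * S)), ← integral_sub (hAΦ.const_mul _) hAwρ]
    exact integral_congr_ae (Eventually.of_forall e)
  -- (d) duality at the times `s > 0` with the weight `W`
  have hdu : ∀ s : ℝ, 0 < s →
      Integrable (fun y => |A y| * ∫ x, |W x| * ρ x ∂(Kr s.toNNReal y)) ∧
      (∫ y, |A y| * ∫ x, |W x| * ρ x ∂(Kr s.toNNReal y)) ≤ Real.exp (-(2 * γ * s)) *
        (CW * CA * Real.exp (θ * γ * (T + T) * s) *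
          ∫ x, Real.exp (2 * θ * Hm x) * ρ x) ∧
      ∫ x, W x * ρ x * (∫ y, A y ∂(K s.toNNReal x)) = Real.exp (2 * γ * s) * ∫ y, A y * Ψ s y := by
    intro s hs
    have h := pinnedChain_gibbs_duality hω hl hβ hγ hM hT hT hT hθ0 hθ' h2θ hWc hAc hWb hAb
      (Real.toNNReal_pos.2 hs)
    rwa [Real.coe_toNNReal _ hs.le] at h
  -- (e) joint measurability of `(s, y) ↦ Ψ s y` and integrability of `G` on `(0, S] × Ω`
  have hΨm : StronglyMeasurable fun q : ℝ × PhaseSpace (N + 1) => Ψ q.1 q.2 :=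
    stronglyMeasurable_integral_langevinRevKernel hP (N + 1) T T (hWc.mul hρc).stronglyMeasurable
  set G : ℝ → PhaseSpace (N + 1) → ℝ := fun s y => A y * (Real.exp (2 * γ * s) * Ψ s y) with hG
  have hGm : StronglyMeasurable (Function.uncurry G) := by
    have h1 : StronglyMeasurable fun q : ℝ × PhaseSpace (N + 1) => A q.2 :=
      (hAc.comp continuous_snd).stronglyMeasurable
    have h2 : StronglyMeasurable fun q : ℝ × PhaseSpace (N + 1) => Real.exp (2 * γ * q.1) :=
      (Real.continuous_exp.comp ((continuous_const.mul continuous_id).comp continuous_fst)).stronglyMeasurable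
    exact h1.mul (h2.mul hΨm)
  set I₂ := ∫ x, Real.exp (2 * θ * Hm x) * ρ x with hI₂
  set Bd := CW * CA * Real.exp (θ * γ * (T + T) * S) * I₂ with hBd
  have hGs : ∀ s : ℝ, 0 < s → s ≤ S → Integrable (G s) ∧ ∫ y, ‖G s y‖ ≤ Bd := by
    intro s hs hsS
    obtain ⟨hi, hbd, -⟩ := hdu s hs
    have hΨs : StronglyMeasurable (Ψ s) :=
      (hWc.mul hρc).stronglyMeasurable.integral_kernel (κ := Kr s.toNNReal)
    have hptw : ∀ y, ‖G s y‖ ≤ Real.exp (2 * γ * s) * (|A y| * ∫ x, |W x| * ρ x ∂(Kr s.toNNReal y)) := by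
      intro y
      have h1 : ‖Ψ s y‖ ≤ ∫ x, |W x| * ρ x ∂(Kr s.toNNReal y) :=
        calc ‖Ψ s y‖ ≤ ∫ x, ‖W x * ρ x‖ ∂(Kr s.toNNReal y) := norm_integral_le_integral_norm _
          _ = ∫ x, |W x| * ρ x ∂(Kr s.toNNReal y) := integral_congr_ae (Eventually.of_forall fun x => by
              show ‖W x * ρ x‖ = |W x| * ρ x
              rw [norm_mul, Real.norm_eq_abs, Real.norm_of_nonneg (hρ0 x)])
      show ‖A y * (Real.exp (2 * γ * s) * Ψ s y)‖ ≤ _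
      rw [norm_mul, norm_mul, Real.norm_eq_abs, Real.norm_of_nonneg (Real.exp_pos _).le]
      calc |A y| * (Real.exp (2 * γ * s) * ‖Ψ s y‖) = Real.exp (2 * γ * s) * (|A y| * ‖Ψ s y‖) := by ring
        _ ≤ Real.exp (2 * γ * s) * (|A y| * ∫ x, |W x| * ρ x ∂(Kr s.toNNReal y)) :=
            mul_le_mul_of_nonneg_left (mul_le_mul_of_nonneg_left h1 (abs_nonneg _)) (Real.exp_pos _).le
    have hint : Integrable (G s) := (hi.const_mul (Real.exp (2 * γ * s))).mono'
      (hAc.aestronglyMeasurable.mul ((continuous_const.aestronglyMeasurable).mul hΨs.aestronglyMeasurable))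
      (Eventually.of_forall hptw)
    refine ⟨hint, ?_⟩
    have hI₂ : 0 ≤ I₂ := integral_nonneg fun x => mul_nonneg (Real.exp_pos _).le (hρ0 x)
    have hrate : 0 ≤ θ * γ * (T + T) := mul_nonneg (mul_nonneg hθ0.le hγ) (by linarith)
    calc ∫ y, ‖G s y‖ ≤ ∫ y, Real.exp (2 * γ * s) * (|A y| * ∫ x, |W x| * ρ x ∂(Kr s.toNNReal y)) :=
          integral_mono hint.norm (hi.const_mul _) hptw
      _ = Real.exp (2 * γ * s) * ∫ y, |A y| * ∫ x, |W x| * ρ x ∂(Kr s.toNNReal y) := integral_const_mul _ _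
      _ ≤ Real.exp (2 * γ * s) * (Real.exp (-(2 * γ * s)) *
          (CW * CA * Real.exp (θ * γ * (T + T) * s) * I₂)) :=
          mul_le_mul_of_nonneg_left hbd (Real.exp_pos _).le
      _ = CW * CA * Real.exp (θ * γ * (T + T) * s) * I₂ := by
          rw [← mul_assoc, ← Real.exp_add, show 2 * γ * s + -(2 * γ * s) = 0 by ring, Real.exp_zero, one_mul]
      _ ≤ Bd := by
          have hexp : Real.exp (θ * γ * (T + T) * s) ≤ Real.exp (θ * γ * (T + T) * S) :=
            Real.exp_le_exp.2 (mul_le_mul_of_nonneg_left hsS hrate)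
          exact mul_le_mul_of_nonneg_right (mul_le_mul_of_nonneg_left hexp (by positivity)) hI₂
  have hGint : Integrable (Function.uncurry G) ((volume.restrict (Ioc 0 S)).prod volume) := by
    rw [integrable_prod_iff hGm.aestronglyMeasurable]
    constructor
    · exact (ae_restrict_iff' measurableSet_Ioc).2 (Eventually.of_forall fun s hs => (hGs s hs.1 hs.2).1)
    · refine Integrable.of_bound hGm.norm.aestronglyMeasurable.integral_prod_right' Bd ?_
      exact (ae_restrict_iff' measurableSet_Ioc).2 (Eventually.of_forall fun s hs => by
        rw [Real.norm_of_nonneg (integral_nonneg fun y => norm_nonneg _)]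
        exact (hGs s hs.1 hs.2).2)
  -- (f) exchange the integrals and use duality backwards
  rw [hstep]
  calc ∫ y, ∫ s in (0:ℝ)..S, A y * (Real.exp (2 * γ * s) * Ψ s y)
      = ∫ y, ∫ s in Ioc 0 S, G s y :=
        integral_congr_ae (Eventually.of_forall fun y => intervalIntegral.integral_of_le hS)
    _ = ∫ s in Ioc 0 S, ∫ y, G s y := (integral_integral_swap hGint).symm
    _ = ∫ s in Ioc 0 S, ∫ x, W x * (∫ y, A y ∂(K s.toNNReal x)) * ρ x := by
        refine setIntegral_congr_fun measurableSet_Ioc fun s hs => ?_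
        obtain ⟨-, -, hd⟩ := hdu s hs.1
        calc ∫ y, G s y = ∫ y, Real.exp (2 * γ * s) * (A y * Ψ s y) :=
              integral_congr_ae (Eventually.of_forall fun y => by
                show A y * (Real.exp (2 * γ * s) * Ψ s y) = Real.exp (2 * γ * s) * (A y * Ψ s y); ring)
          _ = Real.exp (2 * γ * s) * ∫ y, A y * Ψ s y := integral_const_mul _ _
          _ = ∫ x, W x * ρ x * ∫ y, A y ∂(K s.toNNReal x) := hd.symm
          _ = ∫ x, W x * (∫ y, A y ∂(K s.toNNReal x)) * ρ x :=
              integral_congr_ae (Eventually.of_forall fun x => by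
                show W x * ρ x * (∫ y, A y ∂(K s.toNNReal x)) = W x * (∫ y, A y ∂(K s.toNNReal x)) * ρ x; ring)
    _ = ∫ s in (0:ℝ)..S, ∫ x, W x * (∫ y, A y ∂(K s.toNNReal x)) * ρ x :=
        (intervalIntegral.integral_of_le hS).symm

/-- **Registered sub-goal `twoModeBulk_testedDynkinOfPointwise`** of crux stmt-AtomisticToContinuum-12111 (line `Sketch`,
corrector identity (★), part 2): `pinnedChain_testedDynkin_of_pointwise` as a closed statement (`ω₂ > 0`,
`lam, β, γ ≥ 0`, `N + 1` sites, `T > 0`, continuous `w, W, A` of class `O(e^{H/(4T)})`, the pointwise Doob–Dynkin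
identity for `w` with flipped generator `W`, `S ≥ 0`). [folklore] -/
theorem twoModeBulk_testedDynkinOfPointwise :
    ∀ ω₂ lam β γ : ℝ, 0 < ω₂ → 0 ≤ lam → 0 ≤ β → 0 ≤ γ → ∀ (N : ℕ) (T : ℝ), 0 < T → ∀ (w W A : Literature.MathematicalPhysics.KineticTheory.HeatConduction.PhaseSpace (N + 1) → ℝ) (Cw CW CA : ℝ), Continuous w → Continuous W → Continuous A → (∀ x, |w x| ≤ Cw * Real.exp (1 / (4 * T) * (Literature.MathematicalPhysics.KineticTheory.HeatConduction.pinnedChain ω₂ lam β γ).hamiltonian (N + 1) x)) → (∀ x, |W x| ≤ CW * Real.exp (1 / (4 * T) * (Literature.MathematicalPhysics.KineticTheory.HeatConduction.pinnedChain ω₂ lam β γ).hamiltonian (N + 1) x)) → (∀ x, |A x| ≤ CA * Real.exp (1 / (4 * T) * (Literature.MathematicalPhysics.KineticTheory.HeatConduction.pinnedChain ω₂ lam β γ).hamiltonian (N + 1) x)) → (∀ u : ℝ, 0 ≤ u → ∀ y : Literature.MathematicalPhysics.KineticTheory.HeatConduction.PhaseSpace (N + 1), Real.exp (2 * γ * u)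 * (∫ x, w x * (Literature.MathematicalPhysics.KineticTheory.HeatConduction.pinnedChain ω₂ lam β γ).gibbsDensity (N + 1) T x ∂((Literature.MathematicalPhysics.KineticTheory.HeatConduction.pinnedChain ω₂ lam β γ).langevinRevKernel (N + 1) T T u.toNNReal y)) - w y * (Literature.MathematicalPhysics.KineticTheory.HeatConduction.pinnedChain ω₂ lam β γ).gibbsDensity (N + 1) T y = ∫ s in (0 : ℝ)..u, Real.exp (2 * γ * s) * ∫ x, W x * (Literature.MathematicalPhysics.KineticTheory.HeatConduction.pinnedChain ω₂ lam β γ).gibbsDensity (N + 1) T x ∂((Literature.MathematicalPhysics.KineticTheory.HeatConduction.pinnedChain ω₂ lam β γ).langevinRevKernel (N + 1) T T s.toNNReal y)) → ∀ S : ℝ, 0 ≤ S → (∫ x, w x * (∫ y, A y ∂((Literature.MathematicalPhysics.KineticTheory.HeatConduction.pinnedChain ω₂ lam β γ).transitionKernel (N + 1) T T S.toNNReal x)) * (Literature.MathematicalPhysics.KineticTheory.HeatConduction.pinnedChain ω₂ lam β γ).gibbsDensity (N + 1) T x) - ∫ x, w x * A x * (Literature.MathematicalPhysics.KineticTheory.HeatConduction.pinnedChain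 ω₂ lam β γ).gibbsDensity (N + 1) T x = ∫ s in (0 : ℝ)..S, ∫ x, W x * (∫ y, A y ∂((Literature.MathematicalPhysics.KineticTheory.HeatConduction.pinnedChain ω₂ lam β γ).transitionKernel (N + 1) T T s.toNNReal x)) * (Literature.MathematicalPhysics.KineticTheory.HeatConduction.pinnedChain ω₂ lam β γ).gibbsDensity (N + 1) T x :=
  fun _ _ _ _ hω hl hβ hγ N _ hT _ _ _ _ _ _ hwc hWc hAc hwb hWb hAb hpt _ hS =>
    pinnedChain_testedDynkin_of_pointwise hω hl hβ hγ N hT hwc hWc hAc hwb hWb hAb hpt hS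

end Summit.AtomisticToContinuum.FouriersLaw.Theorems.TwoModeBulk.Sketch

end
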